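import Mathlib
import Literature.Analysis.FluidPDE.Tao2016AveragedNS.ShiftSetCascadeFlows
import Summits.NavierStokesRegularity.NavierStokesRegularity.Theorems.TaoLadderRungTwoFlatAbstractGronwall
import Summits.NavierStokesRegularity.NavierStokesRegularity.Theorems.TaoLadderRungTwoFlatFlowContinuity
import Summits.NavierStokesRegularity.NavierStokesRegularity.Theorems.TaoLadderRungTwoFlatPulseSymmetry
import Summits.NavierStokesRegularity.NavierStokesRegularity.Theorems.TaoLadderRungTwoFlatCaptureDefs
import Summits.NavierStokesRegularity.NavierStokesRegularity.Theorems.TaoLadderRungTwoFlatSplitLayerDefs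
import Summits.NavierStokesRegularity.NavierStokesRegularity.Theorems.TaoLadderRungTwoFlatDatumExistence
import HarnessLib

/-!
# UNIQUENESS of datum solutions in the locally bounded class; the datum solution is THE trajectory that (S3)
  speaks about (referee carry A-79 of cell harvest/h2-tao-ladder, closed)
  (helper for item stmt-NavierStokesRegularity-22987 `FlatGapCertificatesV2`, crux K_A♭ of route
  TaoLadderRungTwoFlat; p1 g20)

`MirrorPulse.IsDatumSol ε X₀ X` (`…CaptureDefs`) asks for an exact global solution of the homogeneous mirror lattice
from the one-shell datum `X₀`, bounded on every compact time interval only. The tree's uniqueness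
(`…FlowContinuity.globalSol_unique`) wants a GLOBAL amplitude bound; here the Gronwall argument is run on `[0, T]`
with the abstract Picard–Gronwall lemma `LatticeGronwall.abs_le_exp_abstract` (index type `Fin m × ℤ`, coupling
constant `2‖α‖₁ M_T`), and backwards in time through the reversal `t ↦ −X(−t)` (`FlowSymmetry.scaleFam (−1)`):

* `QuadPolar.globalSol_eq_of_locally_bounded` — two exact global solutions (any `m`, shift set, table; ratio `1`)
  with the same data, both bounded on `[−T, T]` for every `T`, coincide at all times;
* `MirrorPulse.isDatumSol_unique` — **datum solutions are unique**; with `…DatumExistence.exists_isDatumSol` every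
  datum solution is uniformly bounded by `‖X₀‖` (`IsDatumSol.abs_le`, `IsDatumSol.isBddFam`) and conserves the energy
  `∑ₙ ∑ᵢ X_{i,n}(t)² = ∑ᵢ X₀ᵢ²` (`IsDatumSol.hasSum_sq`);
* `MirrorPulse.capturedBy_iff_exists` — (S3) `CapturedBy ε Φ X₀` (universally quantified over datum solutions) is
  EQUIVALENT to its existential form; `CapturedWithHeadroom.capturedBy` — theory-1's (S3♯) implies (S3).

HONEST FRAMING: elementary ODE uniqueness for a MODEL lattice; no pulse is constructed, nothing is certified, nothing
here is a statement about the Navier–Stokes equations.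
-/

noncomputable section

-- the sub-problem namespace repeats the summit name by design (D-0017)
set_option linter.dupNamespace false

namespace Summit.NavierStokesRegularity.NavierStokesRegularity.Theorems

open Set Filter Literature.Analysis.FluidPDE Literature.Analysis.FluidPDE.TaoCascade
open scoped Topology

namespace QuadPolar

variable {m : ℕ}

/-- **Forward uniqueness on `[0, T]` from bounds on `[0, T]` only**: two exact global solutions of the ratio-`1`
lattice (any shift set, any table) with the same data at `0`, both bounded by `M` on `[0, T]`, agree on `[0, T]`
(abstract Picard–Gronwall over the index type `Fin m × ℤ` with coupling `2‖α‖₁M`).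
[cite: Tao2016AveragedNS, §4 (4.8); folklore (Gronwall)] -/
theorem globalSol_eqOn_Icc (𝕊 : Finset (ℤ × ℤ × ℤ)) (α : Fin m → Fin m → Fin m → ℤ × ℤ × ℤ → ℝ)
    {X W : Fin m → ℤ → ℝ → ℝ} {M T : ℝ}
    (hX : ∀ i n t, HasDerivAt (X i n) (quadTermOn 𝕊 0 α X i n t) t)
    (hW : ∀ i n t, HasDerivAt (W i n) (quadTermOn 𝕊 0 α W i n t) t)
    (hXb : ∀ i n, ∀ t ∈ Icc 0 T, |X i n t| ≤ M) (hWb : ∀ i n, ∀ t ∈ Icc 0 T, |W i n t| ≤ M)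
    (h0 : ∀ i n, X i n 0 = W i n 0) (i : Fin m) (n : ℤ) {s : ℝ} (hs : s ∈ Icc 0 T) : X i n s = W i n s := by
  set Ψ : Fin m → ℤ → ℝ → ℝ := (1 / 2 : ℝ) • (X + W) with hΨ
  set η : Fin m → ℤ → ℝ → ℝ := X - W with hη
  have hXc : ∀ j k, Continuous (X j k) := fun j k => continuous_iff_continuousAt.2 fun t => (hX j k t).continuousAt
  have hWc : ∀ j k, Continuous (W j k) := fun j k => continuous_iff_continuousAt.2 fun t => (hW j k t).continuousAt
  have hΨc : ∀ j k, Continuous (Ψ j k) := fun j k => by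
    show Continuous fun t => (1 / 2 : ℝ) * (X j k t + W j k t)
    exact continuous_const.mul ((hXc j k).add (hWc j k))
  have hηc : ∀ j k, Continuous (η j k) := fun j k => by
    show Continuous fun t => X j k t - W j k t
    exact (hXc j k).sub (hWc j k)
  have hder : ∀ j k t, HasDerivAt (η j k) (linTermOn 𝕊 0 α Ψ η j k t) t := fun j k t => by
    rw [hΨ, hη, ← quadTermOn_sub_eq_linTermOn_mid]
    exact (hX j k t).sub (hW j k t)
  have hM : 0 ≤ M := (abs_nonneg _).trans (hXb i n 0 ⟨le_rfl, hs.1.trans hs.2⟩)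
  have hK : 0 ≤ 2 * tableAbsSum 𝕊 α * M := by have := tableAbsSum_nonneg 𝕊 α; positivity
  -- abstract Gronwall over the index type `Fin m × ℤ`
  have hdom : LatticeGronwall.IsLocallyDominated (2 * tableAbsSum 𝕊 α * M) 0 T
      (fun p : Fin m × ℤ => η p.1 p.2) (fun p t => linTermOn 𝕊 0 α Ψ η p.1 p.2 t) := by
    intro t ht m' hm' hb p
    rw [add_zero]
    have hΨb : ∀ j k, |Ψ j k t| ≤ M := fun j k => by
      show |(1 / 2 : ℝ) * (X j k t + W j k t)| ≤ M
      rw [abs_mul, abs_of_pos (by norm_num : (0 : ℝ) < 1 / 2)]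
      linarith [abs_add_le (X j k t) (W j k t), hXb j k t ht, hWb j k t ht]
    exact abs_linTermOn_zero_le 𝕊 α hΨb (fun j k => hb (j, k)) p.1 p.2
  have hbdd : ∀ p : Fin m × ℤ, ∀ t ∈ Icc 0 T, |η p.1 p.2 t| ≤ 2 * M := fun p t ht => by
    show |X p.1 p.2 t - W p.1 p.2 t| ≤ 2 * M
    linarith [abs_sub (X p.1 p.2 t) (W p.1 p.2 t), hXb p.1 p.2 t ht, hWb p.1 p.2 t ht]
  have hB : ∀ p : Fin m × ℤ, |η p.1 p.2 0| ≤ 0 := fun p => by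
    show |X p.1 p.2 0 - W p.1 p.2 0| ≤ 0
    rw [h0, sub_self, abs_zero]
  have h := LatticeGronwall.abs_le_exp_abstract (ι := Fin m × ℤ) hK le_rfl hdom (fun p t => hder p.1 p.2 t)
    (fun p => continuous_linTermOn 𝕊 0 α hΨc hηc p.1 p.2) hbdd hB (i, n) hs
  simp only [zero_mul, add_zero] at h
  have h' : |X i n s - W i n s| ≤ 0 := h
  have := abs_nonpos_iff.mp h'
  linarith

/-- **Uniqueness in the LOCALLY BOUNDED class, all times**: two exact global solutions of the ratio-`1` lattice with
the same data at `0`, each bounded on every `[−T, T]`, coincide (backwards in time via `t ↦ −X(−t)`, which is again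
a solution since `Q(−X) = Q(X)`). [cite: Tao2016AveragedNS, §4 (4.8); folklore (Gronwall)] -/
theorem globalSol_eq_of_locally_bounded (𝕊 : Finset (ℤ × ℤ × ℤ))
    (α : Fin m → Fin m → Fin m → ℤ × ℤ × ℤ → ℝ) {X W : Fin m → ℤ → ℝ → ℝ}
    (hX : ∀ i n t, HasDerivAt (X i n) (quadTermOn 𝕊 0 α X i n t) t)
    (hW : ∀ i n t, HasDerivAt (W i n) (quadTermOn 𝕊 0 α W i n t) t)
    (hXb : ∀ T : ℝ, ∃ M : ℝ, ∀ i n, ∀ t ∈ Icc (-T) T, |X i n t| ≤ M)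
    (hWb : ∀ T : ℝ, ∃ M : ℝ, ∀ i n, ∀ t ∈ Icc (-T) T, |W i n t| ≤ M)
    (h0 : ∀ i n, X i n 0 = W i n 0) : X = W := by
  have key : ∀ {X W : Fin m → ℤ → ℝ → ℝ}, (∀ i n t, HasDerivAt (X i n) (quadTermOn 𝕊 0 α X i n t) t) →
      (∀ i n t, HasDerivAt (W i n) (quadTermOn 𝕊 0 α W i n t) t) →
      (∀ T : ℝ, ∃ M : ℝ, ∀ i n, ∀ t ∈ Icc (-T) T, |X i n t| ≤ M) →
      (∀ T : ℝ, ∃ M : ℝ, ∀ i n, ∀ t ∈ Icc (-T) T, |W i n t| ≤ M) →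
      (∀ i n, X i n 0 = W i n 0) → ∀ i n s, 0 ≤ s → X i n s = W i n s := by
    intro X W hX hW hXb hWb h0 i n s hs
    obtain ⟨MX, hMX⟩ := hXb s
    obtain ⟨MW, hMW⟩ := hWb s
    exact globalSol_eqOn_Icc 𝕊 α (M := max MX MW) (T := s) hX hW
      (fun j k t ht => (hMX j k t ⟨by linarith [ht.1], ht.2⟩).trans (le_max_left _ _))
      (fun j k t ht => (hMW j k t ⟨by linarith [ht.1], ht.2⟩).trans (le_max_right _ _)) h0 i n ⟨hs, le_rfl⟩
  -- the reversed families `t ↦ −X(−t)`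
  have hrev : ∀ {X : Fin m → ℤ → ℝ → ℝ}, (∀ i n t, HasDerivAt (X i n) (quadTermOn 𝕊 0 α X i n t) t) →
      ∀ i n t, HasDerivAt (FlowSymmetry.scaleFam (-1) X i n) (quadTermOn 𝕊 0 α (FlowSymmetry.scaleFam (-1) X) i n t) t := by
    intro X hX i n t
    have h1 : HasDerivAt (fun s => X i n ((-1) * s)) (quadTermOn 𝕊 0 α X i n ((-1) * t) * (-1)) t := by
      have hg : HasDerivAt (fun s : ℝ => (-1) * s) (-1) t := by simpa using (hasDerivAt_id t).const_mul (-1 : ℝ)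
      exact (hX i n ((-1) * t)).comp t hg
    have h2 := h1.const_mul (-1)
    have e : quadTermOn 𝕊 0 α (FlowSymmetry.scaleFam (-1) X) i n t = (-1) ^ 2 * quadTermOn 𝕊 0 α X i n ((-1) * t) :=
      FlowSymmetry.quadTermOn_scale_time 𝕊 0 α (-1) X (fun s => (-1) * s) i n t
    show HasDerivAt (fun s => (-1) * X i n ((-1) * s)) _ t
    rw [e]
    exact h2.congr_deriv (by ring)
  have hrevb : ∀ {X : Fin m → ℤ → ℝ → ℝ}, (∀ T : ℝ, ∃ M : ℝ, ∀ i n, ∀ t ∈ Icc (-T) T, |X i n t| ≤ M) →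
      ∀ T : ℝ, ∃ M : ℝ, ∀ i n, ∀ t ∈ Icc (-T) T, |FlowSymmetry.scaleFam (-1) X i n t| ≤ M := by
    intro X hXb T
    obtain ⟨M, hM⟩ := hXb T
    refine ⟨M, fun i n t ht => ?_⟩
    simp only [FlowSymmetry.scaleFam, neg_mul, one_mul, abs_neg]
    exact hM i n (-t) ⟨by linarith [ht.2], by linarith [ht.1]⟩
  funext i n s
  rcases le_or_gt 0 s with hs | hs
  · exact key hX hW hXb hWb h0 i n s hs
  · have h := key (hrev hX) (hrev hW) (hrevb hXb) (hrevb hWb)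
      (fun j k => by simp [FlowSymmetry.scaleFam, h0 j k]) i n (-s) (by linarith)
    simp only [FlowSymmetry.scaleFam, neg_mul, one_mul, neg_neg] at h
    linarith

end QuadPolar

namespace MirrorPulse

open QuadPolar

/-- **DATUM SOLUTIONS ARE UNIQUE**: two datum solutions of `T♭(ε)` from the same one-shell datum coincide at all
times. [cite: Tao2016AveragedNS, §4 (4.8); route TaoLadderRungTwoFlat, λ₀ = 1 layer; folklore (Gronwall)] -/
theorem isDatumSol_unique {ε : ℝ} {X₀ : Fin 2 → ℝ} {X W : Fin 2 → ℤ → ℝ → ℝ} (hX : IsDatumSol ε X₀ X)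
    (hW : IsDatumSol ε X₀ W) : X = W :=
  globalSol_eq_of_locally_bounded shiftSetFlat (mirrorTable ε ε) hX.1 hW.1 hX.2.2 hW.2.2
    fun i n => by rw [hX.2.1, hW.2.1]

/-- Every datum solution is bounded at every site and time by the datum's Euclidean norm `(∑ᵢ X₀ᵢ²)^{1/2}`.
[cite: Tao2016AveragedNS, §4 Lemma 4.1 (4.5) (a priori bound, statement shape); route TaoLadderRungTwoFlat, λ₀ = 1 layer] -/
theorem IsDatumSol.abs_le {ε : ℝ} {X₀ : Fin 2 → ℝ} {X : Fin 2 → ℤ → ℝ → ℝ} (hX : IsDatumSol ε X₀ X)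
    (i : Fin 2) (n : ℤ) (t : ℝ) : |X i n t| ≤ Real.sqrt (∑ j, X₀ j ^ 2) := by
  obtain ⟨Y, hY, -, hYb, -⟩ := exists_isDatumSol ε X₀
  rw [isDatumSol_unique hX hY]
  exact hYb i n t

/-- Every datum solution is uniformly bounded. [cite: Tao2016AveragedNS, §4 (4.5); route TaoLadderRungTwoFlat, λ₀ = 1 layer] -/
theorem IsDatumSol.isBddFam {ε : ℝ} {X₀ : Fin 2 → ℝ} {X : Fin 2 → ℤ → ℝ → ℝ} (hX : IsDatumSol ε X₀ X) :
    IsBddFam X :=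
  ⟨Real.sqrt (∑ j, X₀ j ^ 2), hX.abs_le⟩

/-- **Energy conservation along every datum solution**: `∑ₙ ∑ᵢ X_{i,n}(t)² = ∑ᵢ X₀ᵢ²` for all `t`.
[cite: Tao2016AveragedNS, §4 (4.3) and proof of Lemma 4.1 (v); route TaoLadderRungTwoFlat, λ₀ = 1 layer] -/
theorem IsDatumSol.hasSum_sq {ε : ℝ} {X₀ : Fin 2 → ℝ} {X : Fin 2 → ℤ → ℝ → ℝ} (hX : IsDatumSol ε X₀ X)
    (t : ℝ) : HasSum (fun n : ℤ => ∑ i, X i n t ^ 2) (∑ i, X₀ i ^ 2) := by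
  obtain ⟨Y, hY, -, -, hYe⟩ := exists_isDatumSol ε X₀
  rw [isDatumSol_unique hX hY]
  exact hYe t

/-- **(S3) is equivalent to its existential form**: since the datum solution exists and is unique, `CapturedBy ε Φ X₀`
(stated for EVERY datum solution) holds iff SOME datum solution is captured.
[cite: Tao2016AveragedNS, §6.2 Prop. 6.3 (statement shape); route TaoLadderRungTwoFlat, λ₀ = 1 layer (S3)] -/
theorem capturedBy_iff_exists {ε : ℝ} {Φ : Fin 2 → ℤ → ℝ → ℝ} {X₀ : Fin 2 → ℝ} :
    CapturedBy ε Φ X₀ ↔ ∃ X : Fin 2 → ℤ → ℝ → ℝ, IsDatumSol ε X₀ X ∧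
      ∃ (κ : ℝ) (s : ℕ → ℝ), 0 < κ ∧ StrictMono s ∧
        ∀ (K : ℕ) (δ : ℝ), 0 < δ → ∃ N₀ : ℕ, ∀ N : ℕ, N₀ ≤ N →
          ∀ (i : Fin 2) (k : ℤ), |k| ≤ K → |X i (N + k) (s N) - κ * Φ i k 0| ≤ δ := by
  constructor
  · intro h
    obtain ⟨X, hX, -⟩ := exists_isDatumSol ε X₀
    exact ⟨X, hX, h X hX⟩
  · rintro ⟨X, hX, hcap⟩ W hW
    rw [isDatumSol_unique hW hX]
    exact hcap

/-- **(S3♯) implies (S3)**: theory-1's capture-with-headroom of the datum by `Φ` (observable `i₀`) implies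
`CapturedBy ε Φ X₀`. [cite: Tao2016AveragedNS, §6.2 Prop. 6.3 (statement shape); route TaoLadderRungTwoFlat, λ₀ = 1 layer] -/
theorem CapturedWithHeadroom.capturedBy {ε : ℝ} {Φ : Fin 2 → ℤ → ℝ → ℝ} {X₀ : Fin 2 → ℝ} {i₀ : Fin 2}
    (h : CapturedWithHeadroom ε Φ X₀ i₀) : CapturedBy ε Φ X₀ := by
  obtain ⟨X, κ, η, c, s, hX, hκ, -, hs, -, -, -, hcap⟩ := h
  exact capturedBy_iff_exists.2 ⟨X, hX, κ, s, hκ, hs, hcap⟩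

end MirrorPulse

end Summit.NavierStokesRegularity.NavierStokesRegularity.Theorems

end
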